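import Summits.BirchSwinnertonDyer.Rank1Residual.X4.KuriharaLevelLoweringModPow
import Summits.BirchSwinnertonDyer.Rank1Residual.X4.KuriharaLevelLoweringTwist
import HarnessLib

/-!
# Level lowering kills Kurihara numbers modulo `p^e`, part 2: the mod-`p^e` certificate TRANSPORTS along a quadratic twist `W = V ⊗ χ` — it can be computed on the minimal twist `V` at level `N_V/ℓ` (cell `b2b-bsdres`, seat additive-p4 gen 29, line V49; the exponent form of gen 21/22's `X4/KuriharaLevelLoweringTwist[Minus]`)

HONEST FRAMING (verbatim, cell `b2b-bsdres`): the goal of the cell is to DELETE the COMBINATION-SHAPED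
residual classes for ALL analytic-rank `≤ 1` curves over `ℚ` — "full BSD formula for every rank `≤ 1`
curve in class `C`" assembled STRICTLY from published theorems — so that the rank-`≤ 1` remainder
becomes exactly the CONSTRUCTION-SHAPED classes, which are TYPED (missing-input Props), NOT attempted;
this is not "finishing BSD". This file: research-route KERNEL THEOREMS (pure algebra over the tree's
`ratPlusSymbol` / `ratModP` / `PlusSymbolLevelLowersModAt`; no named fact, no conjecture, no definition,
nothing booked; class X4 stays CONSTRUCTION-SHAPED).

## What is proved

Part 1 (`X4/KuriharaLevelLoweringModPow.lean`) attached to `(E, p, e)` the FINITE certificate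
`PlusSymbolLevelLowersModAt W p f (p^e) ℓ` — a periodic `μ : ℚ → ℤ/p^e`, `T_q`-eigen with `a_q(E)` at
the Kolyvagin primes, with `\overline{[r]⁺_f} = μ(r) − μ(ℓ r)` in `ℤ/p^e` — and proved `∂^{(∞)}(δ̃) ≥ e`
under it. The instrument (E7) computes `μ` in the modular symbols of levels `N`, `N/ℓ`, out of reach
for `N ≳ 3·10⁴` — which is where 204 of the 212 closable `ord_p ∏ c ≥ 3` rows live. On the TWIST-GOOD
locus (`W = V ⊗ χ_D`, `V` of conductor `N₀` prime to `p`; 43 of those rows at `p = 3`, 17 with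
`N₀ < 3·10⁴`; the `p = 5` row 322050bt1 with `N₀ = 12882`) the plus symbol of `f_W` is ONE rational
constant times a `χ`-twisted sum of a symbol of `f_V` (tree theorems
`ModularForms.exists_rat_forall_ratPlusSymbol_charTwist_eq[_of_odd]`, Shimura 3.64 / MTT §I.8), and
gen 21/22 transported the mod-`p` certificate along it. This file is the mod-`p^e` twin:

* §1 `plusSymbolLevelLowersModAt_of_twistSum_fn` (any modulus `M`, any `χ : ℤ/m →* ℤ/M`, any
  `V`-side function `φ : ℚ → ℤ/M`): if `\overline{[r]⁺_{f_W}} = c · ∑_{u mod m} χ(u) φ(r + u/m)` in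
  `ℤ/M`, `φ = μ − w·μ∘[ℓ]` with `μ` periodic and `T_q`-eigen (eigenvalue `e_q`, `χ(q) e_q = a_q(W)`,
  `q` invertible mod `m`, `χ(q)² = 1`) at the Kolyvagin primes of `(W, p)`, `ℓ` invertible mod `m`,
  `χ(ℓ)² = 1` and `w·χ(ℓ) = 1`, then `PlusSymbolLevelLowersModAt W p f_W M ℓ` (witness `c·T_χμ`; the
  ring-general twist algebra of part 4 §1: `isPeriodic_twistSum`, `heckeRel_twistSum`,
  `twistSum_oldform`). So a SPLIT Tamagawa prime `ℓ` of `W` with `χ(ℓ) = −1` is certified modulo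
  `p^e` by the sign `w = −1` identity of the NON-split twist `V` at `ℓ` (`a_ℓ(V) = −1`).
* §2 `plusSymbolLevelLowersModAt_of_ratTwist` (the cell's shape, modulus `p^e`): from a ℚ-LEVEL
  identity `[r]⁺_{f_W} = c₀ · ∑_{u mod m} ε(u) [r + u/m]^±_{f_V}` with an integer-valued `ε`
  reducing to `χ`, a `p`-integral constant `c₀` and `p`-integral `V`-side symbols (so that `ratModP
  (p^e)` is additive and multiplicative on everything in sight, `ratModP_eq_toZModPow`), plus the
  `V`-side mod-`p^e` oldform identity and the twist relation `a_q(W) = χ(q) a_q(V)`: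
  `PlusSymbolLevelLowersModAt W p f_W (p^e) ℓ`. Every consequence of part 1 and of
  `X4/KimDefectLevelLoweringModPow[RankOne]` then applies to `W` with a certificate computed on `V`.

Where the hypotheses come from (not asserted here): the ℚ-identity = the tree's twist theorems (even
`χ`: plus symbol of `V`; odd `χ`, the whole `p = 3` block: minus symbol of `V`) + `p`-adic unit-ness of
`c₀ = Ω_{f_V}/(g(χ)Ω⁺_{f_W})` (period bookkeeping as in `Additive/SemistableTwistAnalytic`; per pair the
instruments read `c₀ = ±1`); the `V`-side identity = a per-pair FINITE certificate (instrument E7 run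
on `V`, sign `w = a_ℓ(V)`), EVIDENCE, never a fact (mod-`p^e` level lowering with multiplicity one is
not in print on X4: Dahmen–Yazdani 2012 Thm. 2 needs `l² ∤ N`).

## References

* B. Mazur, J. Tate, J. Teitelbaum, Invent. Math. 84 (1986), §I.4 (4.2), §I.8. [cite: MazurTateTeitelbaum1986Invent, §I.4 (4.2) and §I.8]
* G. Shimura, *Introduction to the arithmetic theory of automorphic functions* (1971), Prop. 3.64. [cite: Shimura1971, Prop. 3.64]
* C.-H. Kim, Amer. J. Math. 148 (2026), §1.2.2, §1.4.3, Conj. 1.10. [cite: Kim2022StructureSelmer, §1.2.2 and §1.4.3]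
* S. R. Dahmen, S. Yazdani, Canad. J. Math. 64 (2012), Thm. 2 (why a mod-`p^e` certificate is expected; not an input). [cite: DahmenYazdani2012, Thm. 2]
-/

noncomputable section

open scoped MatrixGroups ModularForm

open CongruenceSubgroup Finset

open Literature.NumberTheory.EllipticCurves Literature.NumberTheory.EllipticCurves.ModularForms

open Literature.NumberTheory.DiophantineGeometry.Dioph (ratModP)

namespace Summit.BirchSwinnertonDyer.Rank1Residual.LevelLowering

/-! ### §1 Transport of the mod-`M` certificate from an arbitrary `V`-side function -/

section TransportFn

variable (W : WeierstrassCurve ℚ) [W.IsGloballyMinimal] (p : ℕ) {M : ℕ}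
  {m : ℕ} [NeZero m] (χ : ZMod m →* ZMod M) {NW : ℕ} (fW : CuspForm (Gamma0 NW) 2)

/-- A Hecke relation survives multiplication of the function by a constant. [folklore] -/
private theorem heckeRel_const_mul_mod {R : Type*} [CommRing R] {ν : ℚ → R} {q : ℕ} {a : R}
    (h : HeckeRel ν q a) (c : R) : HeckeRel (fun r ↦ c * ν r) q a := by
  intro r
  have := congrArg (fun x ↦ c * x) (h r)
  simp only [mul_add, Finset.mul_sum] at this
  simp only
  rw [this]
  ring

/-- **TRANSPORT OF THE MOD-`M` CERTIFICATE FROM ANY `V`-SIDE FUNCTION.** If the reduced plus symbol of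
`f_W` is `c` times the `χ`-twisted sum of a function `φ : ℚ → ℤ/M` (`hsym`, in the `ratModP M`
currency of the tree's `kuriharaNumber`), `φ = μ − w·μ∘[ℓ]` is `ℓ`-old with `μ` periodic and
`T_q`-eigen (eigenvalue `e_q`, `χ(q)e_q = a_q(W) mod M`, `q` invertible mod `m`, `χ(q)² = 1`) at the
Kolyvagin primes of `(W, p)`, `ℓ` invertible mod `m`, `χ(ℓ)² = 1`, `w·χ(ℓ) = 1`, then
`PlusSymbolLevelLowersModAt W p f_W M ℓ` (witness `c·T_χμ`; part 4 §1's ring-general twist algebra).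
At `M = p` this is gen 22's `plusSymbolLevelLowersAt_of_twistSum_fn`.
[cite: Kim2022StructureSelmer, §1.2.2 and §1.4.3] [cite: MazurTateTeitelbaum1986Invent, §I.4 (4.2) and §I.8] -/
theorem plusSymbolLevelLowersModAt_of_twistSum_fn (c : ZMod M) (φ : ℚ → ZMod M)
    (hsym : ∀ r : ℚ, ratModP M (ratPlusSymbol fW r) =
      c * ∑ u : ZMod m, χ u * φ (r + (u.val : ℚ) / m))
    {μ : ℚ → ZMod M} (hμ : IsPeriodic μ) {w : ZMod M} {ℓ : ℕ}
    (hV : ∀ r : ℚ, φ r = μ r - w * μ (ℓ * r))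
    (hℓ : IsUnit ((ℓ : ℕ) : ZMod m)) (hχℓ : χ ℓ ^ 2 = 1) (hw : w * χ ℓ = 1)
    (e : ℕ → ZMod M)
    (hH : ∀ q : ℕ, Kato.IsKolyvaginPrime W p 1 q →
      HeckeRel μ q (e q) ∧ IsUnit ((q : ℕ) : ZMod m) ∧ χ q ^ 2 = 1 ∧
        χ q * e q = (W.frobeniusTrace q : ZMod M)) :
    PlusSymbolLevelLowersModAt W p fW M ℓ := by
  refine ⟨fun r ↦ c * ∑ u : ZMod m, χ u * μ (r + (u.val : ℚ) / m), ?_, ?_, ?_⟩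
  · intro r z
    have hper := isPeriodic_twistSum χ hμ r z
    simp only at hper ⊢
    rw [hper]
  · intro q hq
    obtain ⟨hHq, hqu, hχq, haq⟩ := hH q hq
    rw [← haq]
    exact heckeRel_const_mul_mod (heckeRel_twistSum χ hμ hq.prime.ne_zero hqu hχq hHq) c
  · intro r
    rw [hsym r, twistSum_oldform χ hμ hℓ hχℓ hV r, hw, one_mul, mul_sub]

end TransportFn

/-! ### §2 The cell's shape at the modulus `p^e`: from a ℚ-level twist identity with `p`-integral data -/

section RatTwist

variable {p : ℕ} [hp : Fact p.Prime]

/-- `ratModP (p^k)` is multiplicative on `p`-integral rationals (both sides are `toZModPow k` of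
`p`-adic integers, `ratModP_eq_toZModPow`). [folklore] -/
private theorem ratModP_pow_mul_of_not_dvd (k : ℕ) {a b : ℚ} (ha : ¬ p ∣ a.den) (hb : ¬ p ∣ b.den) :
    ratModP (p ^ k) (a * b) = ratModP (p ^ k) a * ratModP (p ^ k) b := by
  have hab : ¬ p ∣ (a * b).den := fun hd ↦ by
    rcases (Nat.Prime.dvd_mul hp.out).mp (hd.trans (Rat.mul_den_dvd a b)) with h | h
    exacts [ha h, hb h]
  rw [ratModP_eq_toZModPow p k ha, ratModP_eq_toZModPow p k hb, ratModP_eq_toZModPow p k hab,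
    ← map_mul]
  congr 1

/-- `ratModP (p^k)` is additive on `p`-integral rationals, and sums of `p`-integral rationals are
`p`-integral. [folklore] -/
private theorem ratModP_pow_sum_of_not_dvd (k : ℕ) {ι : Type*} (s : Finset ι) (g : ι → ℚ)
    (h : ∀ i ∈ s, ¬ p ∣ (g i).den) :
    ¬ p ∣ (∑ i ∈ s, g i).den ∧
      ratModP (p ^ k) (∑ i ∈ s, g i) = ∑ i ∈ s, ratModP (p ^ k) (g i) := by
  classical
  induction s using Finset.induction_on with
  | empty => simp [hp.out.one_lt.ne']
  | insert a s has ih =>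
    have ha : ¬ p ∣ (g a).den := h a (Finset.mem_insert_self a s)
    obtain ⟨hs, hcast⟩ := ih fun i hi ↦ h i (Finset.mem_insert_of_mem hi)
    rw [Finset.sum_insert has, Finset.sum_insert has]
    have hsum : ¬ p ∣ (g a + ∑ i ∈ s, g i).den := fun hd ↦ by
      rcases (Nat.Prime.dvd_mul hp.out).mp (hd.trans (Rat.add_den_dvd (g a) (∑ i ∈ s, g i))) with h1 | h1
      exacts [ha h1, hs h1]
    refine ⟨hsum, ?_⟩
    rw [ratModP_eq_toZModPow p k hsum, ratModP_eq_toZModPow p k ha, ← hcast,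
      ratModP_eq_toZModPow p k hs, ← map_add]
    congr 1

/-- **THE CELL'S TRANSPORT AT THE MODULUS `p^e`.** Data: curves `W` (the pair's curve) and `V` (its
twist), cusp forms `f_W`, `f_V`-side symbol function `σ : ℚ → ℚ` (the plus OR the minus rational symbol
of `f_V`, according to the parity of `χ`), an integer-valued `ε : ℤ/m → ℤ` reducing to the character
`χ : ℤ/m →* ℤ/p^e` (`hε`), and the ℚ-LEVEL twist identity with ONE `p`-integral constant,
`[r]⁺_{f_W} = c₀ · ∑_{u mod m} ε(u) σ(r + u/m)` (`hsym`: the shape of the tree's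
`exists_rat_forall_ratPlusSymbol_charTwist_eq[_of_odd]`; `hc`: `p ∤ den c₀`; `hint`: `σ` is
`p`-integral). `V`-side: the mod-`p^e` `ℓ`-old identity of sign `w` for `\overline{σ}` (`hV`, the
per-pair certificate computed on `V`, `w = a_ℓ(V)`) with `μ` periodic and `T_q`-eigen with eigenvalue
`a_q(V) mod p^e` at the Kolyvagin primes of `(W, p)` (`hHV`), these primes and `ℓ` invertible mod `m`
with `χ² = 1` there (`hunit`, `hℓ`, `hχℓ`), the twist relation `a_q(W) = χ(q) a_q(V)` in `ℤ/p^e`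
(`haq`), and `w·χ(ℓ) = 1`. Conclusion: `PlusSymbolLevelLowersModAt W p f_W (p^e) ℓ` — so `∂^{(∞)} ≥ e`
for `W` and the `ord_p ∏c ≤ e + 1` closures of `X4/KimDefectLevelLoweringModPow` apply to `W` with a
certificate computed at the levels `N_V`, `N_V/ℓ`.
[cite: Kim2022StructureSelmer, §1.2.2 and §1.4.3] [cite: MazurTateTeitelbaum1986Invent, §I.4 (4.2) and §I.8]
[cite: Shimura1971, Prop. 3.64] -/
theorem plusSymbolLevelLowersModAt_of_ratTwist (W V : WeierstrassCurve ℚ) [W.IsGloballyMinimal]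
    [V.IsGloballyMinimal] {e : ℕ} {m : ℕ} [NeZero m] (χ : ZMod m →* ZMod (p ^ e)) (ε : ZMod m → ℤ)
    (hε : ∀ u : ZMod m, ((ε u : ℤ) : ZMod (p ^ e)) = χ u)
    {NW : ℕ} (fW : CuspForm (Gamma0 NW) 2) (σ : ℚ → ℚ)
    (c₀ : ℚ) (hc : ¬ p ∣ c₀.den) (hint : ∀ x : ℚ, ¬ p ∣ (σ x).den)
    (hsym : ∀ r : ℚ, ratPlusSymbol fW r =
      c₀ * ∑ u : ZMod m, (ε u : ℚ) * σ (r + (u.val : ℚ) / m))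
    {μ : ℚ → ZMod (p ^ e)} (hμ : IsPeriodic μ) {w : ZMod (p ^ e)} {ℓ : ℕ}
    (hV : ∀ r : ℚ, ratModP (p ^ e) (σ r) = μ r - w * μ (ℓ * r))
    (hℓ : IsUnit ((ℓ : ℕ) : ZMod m)) (hχℓ : χ ℓ ^ 2 = 1) (hw : w * χ ℓ = 1)
    (hHV : ∀ q : ℕ, Kato.IsKolyvaginPrime W p 1 q → HeckeRel μ q (V.frobeniusTrace q : ZMod (p ^ e)))
    (hunit : ∀ q : ℕ, Kato.IsKolyvaginPrime W p 1 q → IsUnit ((q : ℕ) : ZMod m) ∧ χ q ^ 2 = 1)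
    (haq : ∀ q : ℕ, Kato.IsKolyvaginPrime W p 1 q →
      (W.frobeniusTrace q : ZMod (p ^ e)) = χ q * V.frobeniusTrace q) :
    PlusSymbolLevelLowersModAt W p fW (p ^ e) ℓ := by
  -- the mod-`p^e` twist identity
  have hsymP : ∀ r : ℚ, ratModP (p ^ e) (ratPlusSymbol fW r) =
      ratModP (p ^ e) c₀ * ∑ u : ZMod m, χ u * ratModP (p ^ e) (σ (r + (u.val : ℚ) / m)) := by
    intro r
    have hterm : ∀ u ∈ (Finset.univ : Finset (ZMod m)),
        ¬ p ∣ ((ε u : ℚ) * σ (r + (u.val : ℚ) / m)).den := by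
      intro u _ hd
      have := hd.trans (Rat.mul_den_dvd _ _)
      rw [Rat.den_intCast, one_mul] at this
      exact hint _ this
    obtain ⟨hden, hcast⟩ := ratModP_pow_sum_of_not_dvd (p := p) e Finset.univ _ hterm
    rw [hsym r, ratModP_pow_mul_of_not_dvd e hc hden, hcast]
    congr 1
    refine Finset.sum_congr rfl fun u _ ↦ ?_
    have hεu : ¬ p ∣ ((ε u : ℤ) : ℚ).den := by
      rw [Rat.den_intCast]; exact hp.out.one_lt.ne' ∘ Nat.dvd_one.mp
    rw [ratModP_pow_mul_of_not_dvd e hεu (hint _), ratModP_intCast, hε u]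
  refine plusSymbolLevelLowersModAt_of_twistSum_fn W p χ fW (ratModP (p ^ e) c₀)
    (fun x ↦ ratModP (p ^ e) (σ x)) hsymP hμ hV hℓ hχℓ hw
    (fun q ↦ χ q * (W.frobeniusTrace q : ZMod (p ^ e))) fun q hq ↦ ?_
  obtain ⟨hqu, hχq⟩ := hunit q hq
  refine ⟨?_, hqu, hχq, ?_⟩
  · -- `χ(q) a_q(W) = χ(q)² a_q(V) = a_q(V)`
    have : χ q * (W.frobeniusTrace q : ZMod (p ^ e)) = (V.frobeniusTrace q : ZMod (p ^ e)) := by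
      rw [haq q hq, ← mul_assoc, ← sq, hχq, one_mul]
    rw [this]
    exact hHV q hq
  · rw [← mul_assoc, ← sq, hχq, one_mul]

end RatTwist

end Summit.BirchSwinnertonDyer.Rank1Residual.LevelLowering

end
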